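import Literature.NumberTheory.Rogawski1990.RankOneUnstableTransferUnguardedObstruction   -- FILE B (p08 g14): `not_rankOneUnstableTransferNonsplit_of_isUnramifiedIn`
import Mathlib.NumberTheory.NumberField.Cyclotomic.Ideal
import Mathlib.NumberTheory.NumberField.CMField

/-!
# F0P3a — the (R1-lc) obstruction: the UNGUARDED rank-one unstable letter `RankOneUnstableTransferNonsplit` is FALSE

Crux H413 = stmt-HodgeConjecture-24833, line «N6nsGerm» (`Cruxes/H413/Lines/F0_P3a_N6nsGerm.lean`, row `stub_N6nsR1LL`); LEAD F0P3a-plan (g10) WORD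
T9-1 (1) «NEGATIVE LEMMA → p08 (g14)» (finding F0P3-p02 (g12) 2026-09-01 08:05Z, computation B-p10 (g25) census b80aed6c §2 v2, lineage «=» F0P3-p01 (g13));
seat F0P3a-p08 (g14); precedent ★ `F0P3bQCMJunkObstruction`.  FILE C of three: ★ FILE A `RankOneUnstableUnitParity` (the parity computation over ★ L5), ★ FILE B
`RankOneUnstableTransferUnguardedObstruction` (the refutation at ANY unramified non-split place of ANY CM field), and here the ONE concrete place that closes the bare
negation: `L := ℚ(ζ₄) = ℚ(i)`, `v` the prime of `L⁺` under the unique prime of `𝓞 L` above `3` (Mathlib: `e(3) = 1`, `f(3) = ord₄(3) = 2`, so `#primes = φ(4)∕(e f) = 1` —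
`3` is INERT; the unique prime is fixed by complex conjugation and unramified over `L⁺`).

HONEST LABEL: HC_CM is proved only modulo the 2 remaining named inputs (hLiu418, h413) until rung 0 closes.  WHAT THIS SAYS: the tree's named fact ★
`RankOneUnstableTransferNonsplit` (ED. 2 text of [Rogawski1990 Lemma 4.9.3], quantified over EVERY Hecke character `μ`) is REFUTED — class MISSTATED: print's `μ` restricts
to `ω_{E∕F}` on `𝕀_F`; the μ-guarded re-typing `RankOneUnstableTransferNonsplitCM` (F0P3-p02 (g12), ED. 3) is the repaired letter, and the witness `μ = 1` misses it.
Every ★ consumer used the old constant only as a HYPOTHESIS (vacuously sound); they migrate to `…CM` (LEAD T9-1 (1) ∕ T9-2).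
[cite: Rogawski1990, §4.9 Lemma 4.9.3 (4.9.2) p. 56] [cite: LabesseLanglands1979, §2] [cite: Flicker1998UnitaryFL, §6 p. 95]
-/

set_option linter.dupNamespace false -- the mandated namespace repeats the single-problem summit segment
set_option autoImplicit false

noncomputable section

open NumberField IsDedekindDomain

namespace Summit.HodgeConjecture.HodgeConjecture.Cruxes.H413.F0P3aR1lcObstruction

open Literature.NumberTheory.Rogawski1990 Literature.NumberTheory.Automorphic Literature.NumberTheory.Automorphic.UnitaryGroup

/-- `ord₄(3) = 2`. [folklore] -/
private theorem orderOf_three_zmod_four : orderOf ((3 : ℕ) : ZMod 4) = 2 := by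
  haveI : Fact (Nat.Prime 2) := ⟨Nat.prime_two⟩
  exact orderOf_eq_prime (by decide) (by decide)

/-- **`3` is INERT in `ℚ(ζ₄)`: exactly one prime of `𝓞 ℚ(ζ₄)` lies above `3`** (`#primes · e · f = [ℚ(ζ₄):ℚ] = 2`, `e = 1`, `f = ord₄ 3 = 2`; Mathlib, Roblot 2025).
[cite: NeukirchANT1999, Ch. I §10 Prop. (10.3)] -/
theorem ncard_primesOver_three_cyclotomicField_four :
    (Ideal.primesOver (Ideal.span {((3 : ℕ) : ℤ)}) (𝓞 (CyclotomicField 4 ℚ))).ncard = 1 := by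
  haveI : Fact (Nat.Prime 3) := ⟨Nat.prime_three⟩
  haveI : IsGalois ℚ (CyclotomicField 4 ℚ) := IsCyclotomicExtension.isGalois {4} ℚ (CyclotomicField 4 ℚ)
  have h34 : ¬ 3 ∣ 4 := by decide
  have h := Ideal.ncard_primesOver_mul_ramificationIdxIn_mul_inertiaDegIn (Ideal.span {((3 : ℕ) : ℤ)}) (𝓞 (CyclotomicField 4 ℚ))
    (CyclotomicField 4 ℚ ≃ₐ[ℚ] CyclotomicField 4 ℚ)
  rw [IsCyclotomicExtension.Rat.ramificationIdxIn_eq_of_not_dvd 3 (CyclotomicField 4 ℚ) (m := 4) h34,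
    IsCyclotomicExtension.Rat.inertiaDegIn_eq_of_not_dvd 3 (CyclotomicField 4 ℚ) (m := 4) h34, orderOf_three_zmod_four,
    IsGaloisGroup.card_eq_finrank (CyclotomicField 4 ℚ ≃ₐ[ℚ] CyclotomicField 4 ℚ) ℚ (CyclotomicField 4 ℚ),
    IsCyclotomicExtension.finrank (n := 4) (CyclotomicField 4 ℚ) (Polynomial.cyclotomic.irreducible_rat (by norm_num))] at h
  have htot : Nat.totient 4 = 2 := by decide
  rw [htot] at h
  omega

/-- **THE UNGUARDED RANK-ONE UNSTABLE LETTER IS FALSE**: `¬ RankOneUnstableTransferNonsplit` — ★ FILE B at the CM field `ℚ(ζ₄)` and the place of `ℚ(ζ₄)⁺` under the unique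
(inert, conjugation-fixed, unramified) prime above `3`.  The μ-guarded `RankOneUnstableTransferNonsplitCM` is the repaired letter (print: `μ|𝕀_F = ω_{E∕F}`).
[cite: Rogawski1990, §4.9 Lemma 4.9.3 (4.9.2) p. 56] [cite: LabesseLanglands1979, §2] -/
theorem not_rankOneUnstableTransferNonsplit : ¬ Literature.NumberTheory.Rogawski1990.RankOneUnstableTransferNonsplit := by
  classical
  -- the CM field `L = ℚ(ζ₄)`
  haveI : NeZero ((4 : ℕ) : ℚ) := ⟨by norm_num⟩
  haveI hcyc : IsCyclotomicExtension {4} ℚ (CyclotomicField 4 ℚ) := CyclotomicField.isCyclotomicExtension 4 ℚ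
  haveI hCM : IsCMField (CyclotomicField 4 ℚ) := IsCyclotomicExtension.Rat.isCMField (CyclotomicField 4 ℚ) (S := {4}) ⟨4, rfl, by norm_num⟩
  haveI : Fact (Nat.Prime 3) := ⟨Nat.prime_three⟩
  -- the unique prime `W₀` of `𝓞 L` above `3`
  obtain ⟨⟨W₀, hW₀p, hW₀o⟩⟩ := (Ideal.span {((3 : ℕ) : ℤ)}).nonempty_primesOver (S := 𝓞 (CyclotomicField 4 ℚ))
  obtain ⟨W₁, hW₁⟩ := Set.ncard_eq_one.1 ncard_primesOver_three_cyclotomicField_four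
  have huniq : ∀ P : Ideal (𝓞 (CyclotomicField 4 ℚ)), P.IsPrime → P.LiesOver (Ideal.span {((3 : ℕ) : ℤ)}) → P = W₀ := by
    intro P hP hPo
    have h1 : P ∈ Ideal.primesOver (Ideal.span {((3 : ℕ) : ℤ)}) (𝓞 (CyclotomicField 4 ℚ)) := ⟨hP, hPo⟩
    have h0 : W₀ ∈ Ideal.primesOver (Ideal.span {((3 : ℕ) : ℤ)}) (𝓞 (CyclotomicField 4 ℚ)) := ⟨hW₀p, hW₀o⟩
    rw [hW₁, Set.mem_singleton_iff] at h1 h0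
    rw [h1, h0]
  have h3b : Ideal.span {((3 : ℕ) : ℤ)} ≠ ⊥ := by simp
  haveI := hW₀p
  haveI := hW₀o
  let w₀ : HeightOneSpectrum (𝓞 (CyclotomicField 4 ℚ)) := ⟨W₀, hW₀p, Ideal.ne_bot_of_liesOver_of_ne_bot h3b W₀⟩
  -- the place `v` of `L⁺` under `W₀`, and `w₀` above it
  let v : HeightOneSpectrum (𝓞 ↥(maximalRealSubfield (CyclotomicField 4 ℚ))) := w₀.under (𝓞 ↥(maximalRealSubfield (CyclotomicField 4 ℚ)))
  let w : PlacesOver (CyclotomicField 4 ℚ) v := ⟨w₀, rfl⟩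
  haveI hvo : v.asIdeal.LiesOver (Ideal.span {((3 : ℕ) : ℤ)}) := by
    constructor
    change Ideal.span {((3 : ℕ) : ℤ)} = (W₀.under (𝓞 ↥(maximalRealSubfield (CyclotomicField 4 ℚ)))).under ℤ
    rw [Ideal.under_under]
    exact hW₀o.over
  -- `w₀` is fixed by complex conjugation: `c • W₀` is also a prime above `3`
  have hw : IsCMField.complexConj (CyclotomicField 4 ℚ) • w.1 = w.1 := by
    apply HeightOneSpectrum.ext
    have hover : (IsCMField.complexConj (CyclotomicField 4 ℚ) • w₀).asIdeal.LiesOver v.asIdeal := by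
      constructor
      have h := HeightOneSpectrum.under_algEquiv_smul _ _ (IsCMField.complexConj (CyclotomicField 4 ℚ)) w₀
      exact (congrArg HeightOneSpectrum.asIdeal h).symm
    haveI := hover
    exact huniq _ (IsCMField.complexConj (CyclotomicField 4 ℚ) • w₀).isPrime (Ideal.LiesOver.trans _ v.asIdeal (Ideal.span {((3 : ℕ) : ℤ)}))
  -- `v` is unramified in `L`: `e(P|ℤ) = e(v|ℤ) · e(P|v)` and `e(P|ℤ) = 1`
  have hunr : Algebra.IsUnramifiedIn (𝓞 (CyclotomicField 4 ℚ)) v.asIdeal := by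
    rw [Algebra.isUnramifiedIn_iff_forall_ramificationIdx_eq_one]
    intro P hP hPo
    haveI := hPo
    haveI : P.LiesOver (Ideal.span {((3 : ℕ) : ℤ)}) := Ideal.LiesOver.trans P v.asIdeal (Ideal.span {((3 : ℕ) : ℤ)})
    have h1 : P.ramificationIdx ℤ = 1 := IsCyclotomicExtension.Rat.ramificationIdx_eq_of_not_dvd 3 (CyclotomicField 4 ℚ) P (m := 4) (by decide)
    have htower := Ideal.ramificationIdx_tower (R := ℤ) v.asIdeal P
    rw [h1] at htower
    exact Nat.eq_one_of_mul_eq_one_left htower.symm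
  exact not_rankOneUnstableTransferNonsplit_of_isUnramifiedIn (CyclotomicField 4 ℚ) v w hw hunr

end Summit.HodgeConjecture.HodgeConjecture.Cruxes.H413.F0P3aR1lcObstruction

end
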